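import Summits.CriticalPhenomena.PercolationContinuityZ3.Theorems.PercNearOneGluingNoHeavyLowerTailSahiE4UnionThreeDefs
import Mathlib.Tactic.Linarith
import Mathlib.Tactic.LinearCombination
import Mathlib.Tactic.Ring
import HarnessLib

/-!
# `NoHeavyLowerTail` (crux stmt-CriticalPhenomena-4575), Sahi programme P4 — the THREE-COIN block `b = (c₁c₂, c₂c₃, c₁ ∨ c₃, c₂)` fed to all four members:
# `a`-side Bernstein-coefficient inequalities (part 3)

Support file (cell `prim-l12`, seat P4, generation 39; `--supports stmt-CriticalPhenomena-4575`).  No definitions, no named facts, no sorries;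
standard axioms.  For an independent block on three independent coins `c₁, c₂, c₃` (probabilities `θ₁, θ₂, θ₃`) with members `b = (c₁c₂, c₂c₃, c₁ ∨ c₃, c₂)`, `E₄(a ∨ b)`
and the six order-3 product rows of `u = a ∨ b` are polynomials in the hold moments `t` of `a` and in `θ`; their multivariate BERNSTEIN
COEFFICIENTS with respect to `(1−θ₁, 1−θ₂, 1−θ₃) ∈ [0,1]³` are polynomials in `t` alone, each nonnegative on `AAdmissible t` by an exact LP
certificate in products of at most four of the 85 rows (seat memo of generation 39).  HONEST FRAMING: bookkeeping inequalities for one specific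
block; nothing here is Sahi's conjecture `C₄` itself. [this work]
-/

namespace Summit.CriticalPhenomena.PercolationContinuityZ3.Theorems.SahiE4UnionThreeCoin

open Summit.CriticalPhenomena.PercolationContinuityZ3.Theorems.SahiE4UnionThree

/-- Bernstein coefficient `(2, 2, 1)` of `E₃(u₂u₃,u₀,u₁) ≥ 0` for the three-coin block Z3 (times `6`; 7-term certificate): nonnegative on `AAdmissible`. [this work] -/
theorem cZ3_e3prod23_2_2_1 (t : Fin 15 → ℝ) (hT : AAdmissible t) :
    0 ≤ t 0 - t 4 + 2 * t 10 + 4 * t 11 - t 12 + 4 * t 14 - t 0 * t 7 - 2 * t 0 * t 8 - 2 * t 0 * t 13 - t 1 * t 5 - 2 * t 1 * t 6 - t 1 * t 12 - t 2 * t 4 - 2 * t 3 * t 4 - t 4 * t 9 + t 0 * t 1 * t 2 + 2 * t 0 * t 1 * t 3 + t 0 * t 1 * t 9 := by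
  have p0 := hT.at_12
  have p1 := hT.at_123
  have p2 := hT.at_13
  have p3 := hT.ch_0_123
  have p4 := hT.e3h_012
  have p5 := hT.e3h_013
  have p6 := hT.p3h_23
  linear_combination p0 + p1 + p2 + p3 + p4 + 2 * p5 + p6

/-- Bernstein coefficient `(2, 2, 2)` of `E₃(u₂u₃,u₀,u₁) ≥ 0` for the three-coin block Z3 (times `3`; 2-term certificate): nonnegative on `AAdmissible`. [this work] -/
theorem cZ3_e3prod23_2_2_2 (t : Fin 15 → ℝ) (hT : AAdmissible t) :
    0 ≤ 2 * t 10 + 4 * t 14 - t 0 * t 7 - 2 * t 0 * t 13 - t 1 * t 5 - 2 * t 1 * t 12 - t 2 * t 4 - 2 * t 4 * t 9 + t 0 * t 1 * t 2 + 2 * t 0 * t 1 * t 9 := by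
  have p0 := hT.e3h_012
  have p1 := hT.p3h_23
  linear_combination p0 + 2 * p1

end Summit.CriticalPhenomena.PercolationContinuityZ3.Theorems.SahiE4UnionThreeCoin
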